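import Literature.NumberTheory.LFunctions.HeckeThetaPieces
import HarnessLib

/-!
# The Mellin transform of Hecke's weighted theta integral at real `σ`, as signed coset sums

Topic `Literature/NumberTheory/LFunctions`; namespace `Literature.NumberTheory.LFunctions.NumberField`
(continuing `HeckeThetaPieces.lean`).  Fifth step of the continuation of the partial zeta functions of
narrow ray classes (Neukirch, *Algebraic Number Theory*, VII §8 (8.3) and (8.5), for the cosets `a₀ + 𝔞`
and sign weights `N(x^p)` of Remark 1 after (8.6)): the identification, at REAL `σ > 1/2`, of Mathlib's
completed Mellin transform `Λ(σ)` of the weak FE-pair `heckePairW K p 𝔞 a₀ N` (`HeckeThetaMellin.lean`)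
with the unfolded sums over the representatives `pieceReps` modulo `V = ⟨u_i^N⟩`
(`HeckeThetaPieces.lean`):

* `pieceF K p ς 𝔞 a₀ β t = ∫_{[0,1]^{r-1}} pieceTheta(y(βc,t)) dc ≥ 0`, continuous on `(0, ∞)`, with
  `f(t) - f₀ = pieceF(+1)(t) - pieceF(-1)(t)` (`heckeFW_sub_const_eq_pieceF_sub`);
* for `p = ∅` the piece `-1` vanishes, `f - f₀ ≥ 0`, and the finiteness of the Mellin integral
  (`WeakFEPair.hasMellin`) gives the FINITENESS of the coset Dirichlet series
  `Σ_{x ∈ pieceReps(∅,+1)} |N(x)|^{-2σ}` for `σ > 1/2` (`pieceNormSum_empty_ne_top`), hence of every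
  `Σ_{x ∈ pieceReps(p,ς)} |N(x)|^{-2σ}` (the sign pieces are subsets);
* `heckePairW_Λ_real_eq`: for `σ > 1/2`,
  `Λ(σ) = c_N A_p(σ) · (S⁺(2σ) - S⁻(2σ))`, `S^ς(σ') = Σ_{x ∈ pieceReps(p,ς)} |N(x)|^{-σ'}` (`pieceNormSum`),
  `c_N = N^{-(r-1)} 2^{-(r-1)} n (2^{-r₂} n R)⁻¹` (`pieceCst`), `A_p(σ) = ∏_w (π e_w)^{-κ_w} Γ(κ_w)` (`realGammaFactorP`) — Neukirch's
  `Λ(𝔎,χ,s) = L(f, s/2)` ((8.3)) with the Gamma integrals evaluated and the class sum written over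
  representatives, here for the signed pieces of the coset.

The complexification (identity theorem) and the continuation are in `HeckeThetaContinuation.lean`.

## References

* J. Neukirch, *Algebraic Number Theory*, Grundlehren 322, Springer 1999, Ch. VII §1 (1.4), §8 (8.3), (8.5)
  and Remark 1 after (8.6) (PDF pp. 438–443 of the held copy). [NeukirchANT1999]
-/

noncomputable section

open MeasureTheory Filter Set Complex NumberField NumberField.InfinitePlace NumberField.Units
open scoped Real Topology ENNReal NumberField nonZeroDivisors

namespace Literature.NumberTheory.LFunctions

namespace NumberField

variable {K : Type*} [Field K] [NumberField K]

open scoped Classical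

/-! ## The empty weight: only the piece `+1` -/

omit [NumberField K] in
/-- `N(x^∅) = 1`. [folklore] -/
@[simp] theorem realPow_empty (x : K) : realPow K ∅ x = 1 := by
  simp [realPow]

omit [NumberField K] in
/-- For `p = ∅` the sign piece `+1` is `x ≠ 0`. [folklore] -/
theorem signPiece_empty_one_iff (x : K) : SignPiece K ∅ 1 x ↔ x ≠ 0 := by
  simp [SignPiece]

omit [NumberField K] in
/-- For `p = ∅` the sign piece `-1` is empty. [folklore] -/
theorem not_signPiece_empty_neg_one (x : K) : ¬ SignPiece K ∅ (-1) x := by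
  simp [SignPiece]

/-- For `p = ∅` the piece `-1` of the theta series vanishes. [folklore] -/
theorem pieceTheta_empty_neg_one (I : FractionalIdeal (𝓞 K)⁰ K) (a₀ : K) (y : InfinitePlace K → ℝ) :
    pieceTheta K ∅ (-1) I a₀ y = 0 := by
  rw [pieceTheta]
  simp [not_signPiece_empty_neg_one]

omit [NumberField K] in
/-- For a nonzero `x` the sign of `N(x^p)` is `1` or `-1`. [folklore] -/
theorem sign_realPow_eq_or {p : Finset {w : InfinitePlace K // IsReal w}} {x : K} (hx : x ≠ 0) :
    SignType.sign (realPow K p x) = 1 ∨ SignType.sign (realPow K p x) = -1 := by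
  rcases lt_or_gt_of_ne (realPow_ne_zero p hx) with h | h
  · exact Or.inr (sign_neg h)
  · exact Or.inl (sign_pos h)

/-! ## Continuity of the sign pieces in `y` -/

/-- `y ↦ W_p(y, x)` is continuous. [folklore] -/
theorem continuous_weightedThetaSummand (p : Finset {w : InfinitePlace K // IsReal w}) (x : K) :
    Continuous fun y : InfinitePlace K → ℝ ↦ weightedThetaSummand K p y x := by
  unfold weightedThetaSummand
  exact (continuous_finsetProd _ fun w _ ↦ continuous_const.mul
    (Real.continuous_sqrt.comp (continuous_apply _))).mul (continuous_thetaSummand x)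

/-- The terms of a sign piece are continuous in `y`. [folklore] -/
theorem continuous_pieceTheta_term (p : Finset {w : InfinitePlace K // IsReal w}) (ς : SignType) (x : K) :
    Continuous fun y : InfinitePlace K → ℝ ↦ (if SignPiece K p ς x then weightedThetaSummand K p y x else 0) := by
  by_cases h : SignPiece K p ς x
  · simp only [if_pos h]; exact continuous_weightedThetaSummand p x
  · simp only [if_neg h]; exact continuous_const

/-- On `{y | y ≥ δ}` the terms of a sign piece are dominated by `e^{-π⟨x(δ/2),x⟩}`. [folklore] -/
theorem norm_pieceTheta_term_le (p : Finset {w : InfinitePlace K // IsReal w}) (ς : SignType) {δ : ℝ}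
    (hδ : 0 < δ) {y : InfinitePlace K → ℝ} (hy : ∀ w, δ ≤ y w) (x : K) :
    ‖(if SignPiece K p ς x then weightedThetaSummand K p y x else 0)‖ ≤ thetaSummand K (fun _ ↦ δ / 2) x := by
  have hy0 : ∀ w, 0 ≤ y w := fun w ↦ hδ.le.trans (hy w)
  have hmono : thetaSummand K (fun w ↦ y w / 2) x ≤ thetaSummand K (fun _ ↦ δ / 2) x := by
    rw [thetaSummand_eq_mixedGaussian, thetaSummand_eq_mixedGaussian]
    exact mixedGaussian_le_mixedGaussian K (fun w ↦ by linarith [hy w]) _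
  split_ifs
  · rw [Real.norm_of_nonneg (weightedThetaSummand_nonneg p y x)]
    exact (weightedThetaSummand_le p hy0 x).trans hmono
  · rw [norm_zero]; exact (thetaSummand_pos _ _).le

/-- **The sign pieces are continuous on `{y | y ≥ δ}`** (uniform convergence, as Neukirch VII (3.5)).
[folklore] -/
theorem continuousOn_pieceTheta_of_le (p : Finset {w : InfinitePlace K // IsReal w}) (ς : SignType)
    (I : FractionalIdeal (𝓞 K)⁰ K) (a₀ : K) {δ : ℝ} (hδ : 0 < δ) :
    ContinuousOn (pieceTheta K p ς I a₀) {y | ∀ w, δ ≤ y w} := by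
  refine continuousOn_tsum (fun a ↦ (continuous_pieceTheta_term p ς ((a : K) + a₀)).continuousOn)
    (summable_thetaSummand_add I a₀ (fun _ ↦ half_pos hδ)) fun a y hy ↦ ?_
  exact norm_pieceTheta_term_le p ς hδ hy _

/-- The sign pieces are continuous at every `y > 0`. [folklore] -/
theorem continuousAt_pieceTheta (p : Finset {w : InfinitePlace K // IsReal w}) (ς : SignType)
    (I : FractionalIdeal (𝓞 K)⁰ K) (a₀ : K) {y : InfinitePlace K → ℝ} (hy : ∀ w, 0 < y w) :
    ContinuousAt (pieceTheta K p ς I a₀) y := by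
  obtain ⟨δ, hδ, hmem⟩ := setOf_half_le_mem_nhds hy
  exact (continuousOn_pieceTheta_of_le p ς I a₀ hδ).continuousAt hmem

/-- `c ↦ pieceTheta(y(βc, t))` is continuous. [folklore] -/
theorem continuous_pieceTheta_heckeCoord (p : Finset {w : InfinitePlace K // IsReal w}) (ς : SignType)
    (I : FractionalIdeal (𝓞 K)⁰ K) (a₀ : K) (β t : ℝ) :
    Continuous fun c : Fin (rank K) → ℝ ↦ pieceTheta K p ς I a₀ (heckeCoord K (β • c) t) :=
  continuous_iff_continuousAt.mpr fun c ↦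
    (continuousAt_pieceTheta p ς I a₀ (heckeCoord_pos (β • c) t)).comp
      (f := fun c : Fin (rank K) → ℝ ↦ heckeCoord K (β • c) t) (continuous_heckeCoord_smul β t).continuousAt

/-- **A priori bound** `pieceTheta(y) ≤ θ_{𝔞+(a₀)}(iy/2)` for `y > 0`. [folklore] -/
theorem pieceTheta_le_thetaIdeal (p : Finset {w : InfinitePlace K // IsReal w}) (ς : SignType)
    (I : FractionalIdeal (𝓞 K)⁰ K) (a₀ : K) {y : InfinitePlace K → ℝ} (hy : ∀ w, 0 < y w) :
    pieceTheta K p ς I a₀ y ≤ thetaIdeal K (I ⊔ FractionalIdeal.spanSingleton (𝓞 K)⁰ a₀) (fun w ↦ y w / 2) := by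
  have h1 := pieceTheta_le_weightedThetaTail p ς I a₀ hy
  have h2 := weightedThetaTail_le_thetaIdeal_sub_one p I a₀ hy
  linarith

/-! ## The cube integrals `pieceF` of the sign pieces -/

variable (K) in
/-- **The cube integral of a sign piece**: `pieceF(t) = ∫_{c ∈ [0,1]^{r-1}} pieceTheta(y(βc, t)) dc`
(the `ς`-part of Neukirch's `f_F(𝔎,χ,t) - f(∞)` of VII (8.3), in Hecke's coordinates on the scaled cube).
[cite: NeukirchANT1999, Ch. VII §8 (8.3) Proposition] -/
def pieceF (p : Finset {w : InfinitePlace K // IsReal w}) (ς : SignType) (I : FractionalIdeal (𝓞 K)⁰ K)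
    (a₀ : K) (β t : ℝ) : ℝ :=
  ∫ c in Set.Icc (0 : Fin (rank K) → ℝ) 1, pieceTheta K p ς I a₀ (heckeCoord K (β • c) t)

/-- `pieceF ≥ 0`. [folklore] -/
theorem pieceF_nonneg (p : Finset {w : InfinitePlace K // IsReal w}) (ς : SignType)
    (I : FractionalIdeal (𝓞 K)⁰ K) (a₀ : K) (β t : ℝ) : 0 ≤ pieceF K p ς I a₀ β t :=
  setIntegral_nonneg measurableSet_Icc fun _ _ ↦ pieceTheta_nonneg p ς I a₀ _

/-- For `p = ∅` the cube integral of the piece `-1` vanishes. [folklore] -/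
theorem pieceF_empty_neg_one (I : FractionalIdeal (𝓞 K)⁰ K) (a₀ : K) (β t : ℝ) :
    pieceF K ∅ (-1) I a₀ β t = 0 := by
  simp [pieceF, pieceTheta_empty_neg_one]

/-- The integrand of `pieceF` is integrable on the cube (continuous on a compact set). [folklore] -/
theorem integrableOn_pieceTheta_heckeCoord (p : Finset {w : InfinitePlace K // IsReal w}) (ς : SignType)
    (I : FractionalIdeal (𝓞 K)⁰ K) (a₀ : K) (β t : ℝ) :
    IntegrableOn (fun c : Fin (rank K) → ℝ ↦ pieceTheta K p ς I a₀ (heckeCoord K (β • c) t))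
      (Set.Icc (0 : Fin (rank K) → ℝ) 1) :=
  (continuous_pieceTheta_heckeCoord p ς I a₀ β t).continuousOn.integrableOn_compact isCompact_Icc

/-- `pieceF` as an `ℝ≥0∞`-valued cube integral. [folklore] -/
theorem ofReal_pieceF (p : Finset {w : InfinitePlace K // IsReal w}) (ς : SignType)
    (I : FractionalIdeal (𝓞 K)⁰ K) (a₀ : K) (β t : ℝ) :
    ENNReal.ofReal (pieceF K p ς I a₀ β t) =
      ∫⁻ c in Set.Icc (0 : Fin (rank K) → ℝ) 1, ENNReal.ofReal (pieceTheta K p ς I a₀ (heckeCoord K (β • c) t)) := by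
  rw [pieceF, ofReal_integral_eq_lintegral_ofReal (integrableOn_pieceTheta_heckeCoord p ς I a₀ β t)
    (Filter.Eventually.of_forall fun c ↦ pieceTheta_nonneg p ς I a₀ _)]

/-- **`f(t) - f₀ = pieceF(+1)(t) - pieceF(-1)(t)`**: the theta integral minus its constant term, split by
the sign of `N(x^p)` (from `heckeThetaW_sub_const_eq_pieceTheta_sub`). [folklore] -/
theorem heckeFW_sub_const_eq_pieceF_sub (p : Finset {w : InfinitePlace K // IsReal w})
    (I : FractionalIdeal (𝓞 K)⁰ K) (a₀ : K) (β t : ℝ) :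
    heckeFW K p I a₀ β t - heckeThetaConst K p I a₀ =
      ((pieceF K p 1 I a₀ β t : ℝ) : ℂ) - ((pieceF K p (-1) I a₀ β t : ℝ) : ℂ) := by
  have hint : IntegrableOn (fun c : Fin (rank K) → ℝ ↦ heckeThetaW K p I a₀ (heckeCoord K (β • c) t))
      (Set.Icc (0 : Fin (rank K) → ℝ) 1) volume :=
    (continuous_heckeThetaW_heckeCoord p I a₀ β t).continuousOn.integrableOn_compact isCompact_Icc
  have h1 := integrableOn_pieceTheta_heckeCoord p 1 I a₀ β t
  have h2 := integrableOn_pieceTheta_heckeCoord p (-1) I a₀ β t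
  calc heckeFW K p I a₀ β t - heckeThetaConst K p I a₀
      = ∫ c in Set.Icc (0 : Fin (rank K) → ℝ) 1,
          (heckeThetaW K p I a₀ (heckeCoord K (β • c) t) - heckeThetaConst K p I a₀) := by
        rw [integral_sub hint (integrableOn_const volume_unitCube_lt_top.ne), setIntegral_unitCube_const', heckeFW]
    _ = ∫ c in Set.Icc (0 : Fin (rank K) → ℝ) 1,
          (((pieceTheta K p 1 I a₀ (heckeCoord K (β • c) t) : ℝ) : ℂ) -
            ((pieceTheta K p (-1) I a₀ (heckeCoord K (β • c) t) : ℝ) : ℂ)) :=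
        setIntegral_congr_fun measurableSet_Icc fun c _ ↦
          heckeThetaW_sub_const_eq_pieceTheta_sub p I a₀ (heckeCoord_pos (β • c) t)
    _ = ((pieceF K p 1 I a₀ β t : ℝ) : ℂ) - ((pieceF K p (-1) I a₀ β t : ℝ) : ℂ) := by
        rw [integral_sub (h1.ofReal) (h2.ofReal), pieceF, pieceF, integral_complex_ofReal,
          integral_complex_ofReal]

/-- **`pieceF` is continuous on `(0, ∞)`** (dominated convergence, as `continuousOn_heckeFW`: near `t₀`
the integrand is bounded by `θ_{𝔞+(a₀)}(y(βc, t₀/2)/2)`). [folklore] -/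
theorem continuousOn_pieceF (p : Finset {w : InfinitePlace K // IsReal w}) (ς : SignType)
    (I : FractionalIdeal (𝓞 K)⁰ K) (a₀ : K) (β : ℝ) : ContinuousOn (pieceF K p ς I a₀ β) (Set.Ioi 0) := by
  intro t₀ ht₀
  refine ContinuousAt.continuousWithinAt ?_
  have h2 : 0 < t₀ / 2 := half_pos ht₀
  have hmem : Set.Ioi (t₀ / 2) ∈ 𝓝 t₀ := isOpen_Ioi.mem_nhds (Set.mem_Ioi.mpr (half_lt_self ht₀))
  set J := I ⊔ FractionalIdeal.spanSingleton (𝓞 K)⁰ a₀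
  refine continuousAt_of_dominated (μ := volume.restrict (Set.Icc (0 : Fin (rank K) → ℝ) 1))
    (bound := fun c ↦ thetaIdeal K J (fun w ↦ heckeCoord K (β • c) (t₀ / 2) w / 2)) ?_ ?_ ?_ ?_
  · exact Filter.Eventually.of_forall fun t ↦
      (continuous_pieceTheta_heckeCoord p ς I a₀ β t).aestronglyMeasurable
  · filter_upwards [hmem] with t ht
    refine Filter.Eventually.of_forall fun c ↦ ?_
    have ht' : t₀ / 2 < t := ht
    rw [Real.norm_of_nonneg (pieceTheta_nonneg p ς I a₀ _)]
    refine (pieceTheta_le_thetaIdeal p ς I a₀ (heckeCoord_pos (β • c) t)).trans ?_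
    exact thetaIdeal_le_thetaIdeal K J (fun w ↦ half_pos (heckeCoord_pos _ _ w))
      fun w ↦ by linarith [heckeCoord_mono (β • c) h2 ht'.le w]
  · exact (continuous_thetaIdeal_heckeCoord_half J β (t₀ / 2)).continuousOn.integrableOn_compact
      isCompact_Icc
  · refine Filter.Eventually.of_forall fun c ↦ ?_
    exact (continuousAt_pieceTheta p ς I a₀ (heckeCoord_pos (β • c) t₀)).comp
      (f := fun t ↦ heckeCoord K (β • c) t) (continuousAt_heckeCoord (β • c) ht₀.ne')

/-! ## The unfolded Mellin integral of a piece and the norm sums over representatives -/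

variable (K) in
/-- The real **Gamma factor of weight `p`**, `A_p(σ) = ∏_w (π e_w)^{-κ_w} Γ(κ_w)`, `κ_w = e_w σ + p_w/2`
(`= π^{-nσ - |p|/2} 2^{-2r₂σ} Γ(σ)^{r₁-|p|} Γ(σ + 1/2)^{|p|} Γ(2σ)^{r₂}`; at `σ = s/2` the Euler factor at
infinity of a character of type `p`, Neukirch VII (8.3): `L_∞(χ,s) = L_X(s𝟏+p)`, up to the normalisation of
the complex places). [cite: NeukirchANT1999, Ch. VII §8 (8.3) Proposition] -/
def realGammaFactorP (p : Finset {w : InfinitePlace K // IsReal w}) (σ : ℝ) : ℝ :=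
  ∏ w : InfinitePlace K, (1 / (Real.pi * mult w)) ^ ((mult w : ℝ) * σ + halfWeight K p w) *
    Real.Gamma ((mult w : ℝ) * σ + halfWeight K p w)

variable (K) in
/-- The constant `c_N = N^{-(r-1)} · 2^{-(r-1)} n (2^{-r₂} n R)⁻¹` of the unfolded Mellin transform on the
`N`-scaled cube (Neukirch VII (5.5)/(8.3): cube parametrisation, `dt/t`, covolume of the unit lattice).
[cite: NeukirchANT1999, Ch. VII §8 (8.3) Proposition] -/
def pieceCst (N : ℕ) : ℝ :=
  ((N : ℝ) ^ rank K)⁻¹ * ((2 ^ rank K)⁻¹ * Module.finrank ℚ K *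
    (2⁻¹ ^ nrComplexPlaces K * Module.finrank ℚ K * regulator K)⁻¹)

/-- `A_p(σ) > 0` for `σ > 0`. [folklore] -/
theorem realGammaFactorP_pos (p : Finset {w : InfinitePlace K // IsReal w}) {σ : ℝ} (hσ : 0 < σ) :
    0 < realGammaFactorP K p σ :=
  Finset.prod_pos fun w _ ↦ by
    have : (0 : ℝ) < mult w := Nat.cast_pos.mpr mult_pos
    exact mul_pos (Real.rpow_pos_of_pos (by positivity) _) (Real.Gamma_pos_of_pos (kappa_pos p hσ w))

/-- `c_N > 0` for `N ≠ 0`. [folklore] -/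
theorem pieceCst_pos {N : ℕ} (hN0 : N ≠ 0) : 0 < pieceCst K N := by
  have := regulator_pos K
  have : (0 : ℝ) < Module.finrank ℚ K := Nat.cast_pos.mpr Module.finrank_pos
  have : (0 : ℝ) < N := Nat.cast_pos.mpr (Nat.pos_of_ne_zero hN0)
  unfold pieceCst
  positivity

variable (K) in
/-- The **norm sum over the representatives of a sign piece**, `S^ς_p(σ) = Σ_{x ∈ pieceReps(p,ς)} |N(x)|^{-σ}`
(`ℝ≥0∞`-valued). [folklore] -/
def pieceNormSum (p : Finset {w : InfinitePlace K // IsReal w}) (ς : SignType) (I : FractionalIdeal (𝓞 K)⁰ K)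
    (a₀ : K) (N : ℕ) (σ : ℝ) : ℝ≥0∞ :=
  ∑' x : pieceReps K p ς I a₀ N, ENNReal.ofReal ((|(Algebra.norm ℚ (x : K) : ℚ)| : ℝ) ^ (-σ))

/-- **The Mellin integral of `pieceF` at real `σ > 0`, unfolded**:
`∫_{t>0} t^{σ-1} pieceF(t) dt = c_N A_p(σ) · S^ς_p(2σ)` (`ℝ≥0∞`-valued; Neukirch VII, proof of (8.3), via
`lintegral_Ioi_rpow_mul_lintegral_unitCube_pieceTheta`). [cite: NeukirchANT1999, Ch. VII §8 proof of (8.3)] -/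
theorem lintegral_rpow_mul_pieceF_eq (p : Finset {w : InfinitePlace K // IsReal w}) (ς : SignType)
    (I : FractionalIdeal (𝓞 K)⁰ K) (a₀ : K) {N : ℕ} (hN0 : N ≠ 0) (hN : Even N)
    (hV : ∀ i, (((fundSystem K i : (𝓞 K)ˣ) : K) ^ N - 1) * a₀ ∈ I) {σ : ℝ} (hσ : 0 < σ) :
    ∫⁻ t in Set.Ioi 0, ENNReal.ofReal (t ^ (σ - 1)) * ENNReal.ofReal (pieceF K p ς I a₀ N t) =
      ENNReal.ofReal (pieceCst K N * realGammaFactorP K p σ) * pieceNormSum K p ς I a₀ N (2 * σ) := by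
  simp_rw [ofReal_pieceF]
  rw [lintegral_Ioi_rpow_mul_lintegral_unitCube_pieceTheta p ς I a₀ hN0 hN hV hσ, pieceNormSum,
    ← ENNReal.tsum_mul_left]
  refine tsum_congr fun x ↦ ?_
  rw [← ENNReal.ofReal_mul (mul_pos (pieceCst_pos hN0) (realGammaFactorP_pos p hσ)).le, pieceCst,
    realGammaFactorP, neg_mul]

/-! ## Finiteness: the empty weight and `WeakFEPair.hasMellin` -/

/-- For `p = ∅`, `f(t) - f₀ = pieceF(∅,+1)(t)` is real and nonnegative. [folklore] -/
theorem heckeFW_empty_sub_const (I : FractionalIdeal (𝓞 K)⁰ K) (a₀ : K) (β t : ℝ) :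
    heckeFW K ∅ I a₀ β t - heckeThetaConst K ∅ I a₀ = ((pieceF K ∅ 1 I a₀ β t : ℝ) : ℂ) := by
  rw [heckeFW_sub_const_eq_pieceF_sub, pieceF_empty_neg_one, Complex.ofReal_zero, sub_zero]

/-- **Finiteness of the Mellin integral of `pieceF(∅,+1)`** for `σ > 1/2`: it is the (convergent) Mellin
transform of `f - f₀` for the weak FE-pair `heckePairW K ∅ 𝔞 a₀ β` (Mathlib `WeakFEPair.hasMellin`, i.e. the
Mellin principle, Neukirch VII (1.4)). [cite: NeukirchANT1999, Ch. VII §1 (1.4)] -/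
theorem lintegral_rpow_mul_pieceF_empty_ne_top (I : (FractionalIdeal (𝓞 K)⁰ K)ˣ) (a₀ : K) (β : ℝ)
    {σ : ℝ} (hσ : 1 / 2 < σ) :
    ∫⁻ t in Set.Ioi 0, ENNReal.ofReal (t ^ (σ - 1)) *
      ENNReal.ofReal (pieceF K ∅ 1 (I : FractionalIdeal (𝓞 K)⁰ K) a₀ β t) ≠ ⊤ := by
  set P := heckePairW K ∅ I a₀ β with hP
  have hk : P.k < (σ : ℂ).re := by simp only [hP, heckePairW, Complex.ofReal_re]; exact hσ
  obtain ⟨hconv, -⟩ := P.hasMellin hk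
  set g : ℝ → ℝ := fun t ↦ t ^ (σ - 1) * pieceF K ∅ 1 (I : FractionalIdeal (𝓞 K)⁰ K) a₀ β t with hg
  have hint_eq : Set.EqOn (fun t : ℝ ↦ (t : ℂ) ^ ((σ : ℂ) - 1) • (P.f t - P.f₀))
      (fun t : ℝ ↦ ((g t : ℝ) : ℂ)) (Set.Ioi 0) := by
    intro t ht
    simp only [hP, heckePairW, smul_eq_mul, hg]
    rw [heckeFW_empty_sub_const, Complex.ofReal_mul, Complex.ofReal_cpow (le_of_lt ht)]
    push_cast
    ring
  have hconvR : IntegrableOn g (Set.Ioi 0) := by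
    have h := (IntegrableOn.congr_fun hconv hint_eq measurableSet_Ioi).re
    exact IntegrableOn.congr_fun h (fun t _ ↦ by simp) measurableSet_Ioi
  have hnn : 0 ≤ᵐ[volume.restrict (Set.Ioi 0)] g :=
    (ae_restrict_iff' measurableSet_Ioi).mpr (Filter.Eventually.of_forall fun t (ht : 0 < t) ↦
      mul_nonneg (Real.rpow_nonneg ht.le _) (pieceF_nonneg _ _ _ _ _ _))
  have hlin : ∫⁻ t in Set.Ioi 0, ENNReal.ofReal (t ^ (σ - 1)) *
      ENNReal.ofReal (pieceF K ∅ 1 (I : FractionalIdeal (𝓞 K)⁰ K) a₀ β t) = ENNReal.ofReal (∫ t in Set.Ioi 0, g t) := by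
    rw [ofReal_integral_eq_lintegral_ofReal hconvR hnn]
    refine setLIntegral_congr_fun measurableSet_Ioi fun t (ht : 0 < t) ↦ ?_
    rw [hg, ← ENNReal.ofReal_mul (Real.rpow_nonneg ht.le _)]
  rw [hlin]
  exact ENNReal.ofReal_ne_top

/-- **The coset norm sums are finite**: `S^{+1}_∅(2σ) = Σ_{x ∈ (a₀+𝔞)∖0 mod V} |N(x)|^{-2σ} < ∞` for
`σ > 1/2` (from the finiteness of the Mellin integral and the unfolding; this is the absolute convergence
of the partial zeta function of the coset for `Re(s) > 1`, Neukirch VII (8.1)/(5.2), obtained here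
analytically). [folklore] -/
theorem pieceNormSum_empty_ne_top (I : (FractionalIdeal (𝓞 K)⁰ K)ˣ) (a₀ : K) {N : ℕ} (hN0 : N ≠ 0)
    (hN : Even N) (hV : ∀ i, (((fundSystem K i : (𝓞 K)ˣ) : K) ^ N - 1) * a₀ ∈ (I : FractionalIdeal (𝓞 K)⁰ K))
    {σ : ℝ} (hσ : 1 / 2 < σ) :
    pieceNormSum K ∅ 1 (I : FractionalIdeal (𝓞 K)⁰ K) a₀ N (2 * σ) ≠ ⊤ := by
  intro htop
  have hσ0 : 0 < σ := lt_trans (by norm_num) hσ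
  have h := lintegral_rpow_mul_pieceF_eq ∅ 1 (I : FractionalIdeal (𝓞 K)⁰ K) a₀ hN0 hN hV hσ0
  rw [htop, ENNReal.mul_top (ENNReal.ofReal_pos.mpr
    (mul_pos (pieceCst_pos hN0) (realGammaFactorP_pos ∅ hσ0))).ne'] at h
  exact lintegral_rpow_mul_pieceF_empty_ne_top I a₀ N hσ h

/-- Every sign piece is contained in the piece `(∅, +1)` (all nonzero points of the coset with cone
exponent in the box). [folklore] -/
theorem pieceReps_subset_pieceReps_empty (p : Finset {w : InfinitePlace K // IsReal w}) (ς : SignType)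
    (I : FractionalIdeal (𝓞 K)⁰ K) (a₀ : K) (N : ℕ) :
    pieceReps K p ς I a₀ N ⊆ pieceReps K ∅ 1 I a₀ N := fun _ hx ↦
  ⟨hx.1, (signPiece_empty_one_iff _).mpr hx.2.1.1, hx.2.2⟩

/-- **Every norm sum `S^ς_p(2σ)` is finite** for `σ > 1/2`. [folklore] -/
theorem pieceNormSum_ne_top (p : Finset {w : InfinitePlace K // IsReal w}) (ς : SignType)
    (I : (FractionalIdeal (𝓞 K)⁰ K)ˣ) (a₀ : K) {N : ℕ} (hN0 : N ≠ 0) (hN : Even N)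
    (hV : ∀ i, (((fundSystem K i : (𝓞 K)ˣ) : K) ^ N - 1) * a₀ ∈ (I : FractionalIdeal (𝓞 K)⁰ K))
    {σ : ℝ} (hσ : 1 / 2 < σ) :
    pieceNormSum K p ς (I : FractionalIdeal (𝓞 K)⁰ K) a₀ N (2 * σ) ≠ ⊤ := by
  refine ne_top_of_le_ne_top (pieceNormSum_empty_ne_top I a₀ hN0 hN hV hσ) ?_
  exact ENNReal.tsum_mono_subtype (fun x : K ↦ ENNReal.ofReal ((|(Algebra.norm ℚ x : ℚ)| : ℝ) ^ (-(2 * σ))))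
    (pieceReps_subset_pieceReps_empty p ς _ a₀ N)

/-! ## `Λ(σ)` at real `σ > 1/2` -/

/-- **The Mellin integral of `pieceF` is finite** for `σ > 1/2`. [folklore] -/
theorem lintegral_rpow_mul_pieceF_ne_top (p : Finset {w : InfinitePlace K // IsReal w}) (ς : SignType)
    (I : (FractionalIdeal (𝓞 K)⁰ K)ˣ) (a₀ : K) {N : ℕ} (hN0 : N ≠ 0) (hN : Even N)
    (hV : ∀ i, (((fundSystem K i : (𝓞 K)ˣ) : K) ^ N - 1) * a₀ ∈ (I : FractionalIdeal (𝓞 K)⁰ K))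
    {σ : ℝ} (hσ : 1 / 2 < σ) :
    ∫⁻ t in Set.Ioi 0, ENNReal.ofReal (t ^ (σ - 1)) *
      ENNReal.ofReal (pieceF K p ς (I : FractionalIdeal (𝓞 K)⁰ K) a₀ N t) ≠ ⊤ := by
  rw [lintegral_rpow_mul_pieceF_eq p ς _ a₀ hN0 hN hV (lt_trans (by norm_num) hσ)]
  exact ENNReal.mul_ne_top ENNReal.ofReal_ne_top (pieceNormSum_ne_top p ς I a₀ hN0 hN hV hσ)

/-- **Integrability of `t^{σ-1} pieceF(t)` on `(0,∞)`** for `σ > 1/2`. [folklore] -/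
theorem integrableOn_rpow_mul_pieceF (p : Finset {w : InfinitePlace K // IsReal w}) (ς : SignType)
    (I : (FractionalIdeal (𝓞 K)⁰ K)ˣ) (a₀ : K) {N : ℕ} (hN0 : N ≠ 0) (hN : Even N)
    (hV : ∀ i, (((fundSystem K i : (𝓞 K)ˣ) : K) ^ N - 1) * a₀ ∈ (I : FractionalIdeal (𝓞 K)⁰ K))
    {σ : ℝ} (hσ : 1 / 2 < σ) :
    IntegrableOn (fun t : ℝ ↦ t ^ (σ - 1) * pieceF K p ς (I : FractionalIdeal (𝓞 K)⁰ K) a₀ N t) (Set.Ioi 0) := by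
  have hmeas : AEStronglyMeasurable (fun t : ℝ ↦ t ^ (σ - 1) * pieceF K p ς (I : FractionalIdeal (𝓞 K)⁰ K) a₀ N t)
      (volume.restrict (Set.Ioi 0)) := by
    refine ContinuousOn.aestronglyMeasurable (fun t ht ↦ ?_) measurableSet_Ioi
    exact ((continuousAt_id.rpow_const (Or.inl (ne_of_gt ht))).continuousWithinAt).mul
      (continuousOn_pieceF p ς _ a₀ N t ht)
  refine ⟨hmeas, ?_⟩
  have hnn : 0 ≤ᵐ[volume.restrict (Set.Ioi 0)]
      (fun t : ℝ ↦ t ^ (σ - 1) * pieceF K p ς (I : FractionalIdeal (𝓞 K)⁰ K) a₀ N t) :=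
    (ae_restrict_iff' measurableSet_Ioi).mpr (Filter.Eventually.of_forall fun t (ht : 0 < t) ↦
      mul_nonneg (Real.rpow_nonneg ht.le _) (pieceF_nonneg _ _ _ _ _ _))
  rw [hasFiniteIntegral_iff_ofReal hnn]
  have h := lintegral_rpow_mul_pieceF_ne_top p ς I a₀ hN0 hN hV hσ
  rw [lt_top_iff_ne_top]
  convert h using 1
  refine setLIntegral_congr_fun measurableSet_Ioi fun t (ht : 0 < t) ↦ ?_
  rw [ENNReal.ofReal_mul (Real.rpow_nonneg ht.le _)]

/-- The Mellin integral of `pieceF` as a real number: `∫_{t>0} t^{σ-1} pieceF(t) dt = c_N A_p(σ) S^ς_p(2σ)`.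
[folklore] -/
theorem integral_rpow_mul_pieceF_eq (p : Finset {w : InfinitePlace K // IsReal w}) (ς : SignType)
    (I : (FractionalIdeal (𝓞 K)⁰ K)ˣ) (a₀ : K) {N : ℕ} (hN0 : N ≠ 0) (hN : Even N)
    (hV : ∀ i, (((fundSystem K i : (𝓞 K)ˣ) : K) ^ N - 1) * a₀ ∈ (I : FractionalIdeal (𝓞 K)⁰ K))
    {σ : ℝ} (hσ : 1 / 2 < σ) :
    ∫ t in Set.Ioi 0, t ^ (σ - 1) * pieceF K p ς (I : FractionalIdeal (𝓞 K)⁰ K) a₀ N t =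
      pieceCst K N * realGammaFactorP K p σ * (pieceNormSum K p ς (I : FractionalIdeal (𝓞 K)⁰ K) a₀ N (2 * σ)).toReal := by
  have hσ0 : 0 < σ := lt_trans (by norm_num) hσ
  have hnn : 0 ≤ᵐ[volume.restrict (Set.Ioi 0)]
      (fun t : ℝ ↦ t ^ (σ - 1) * pieceF K p ς (I : FractionalIdeal (𝓞 K)⁰ K) a₀ N t) :=
    (ae_restrict_iff' measurableSet_Ioi).mpr (Filter.Eventually.of_forall fun t (ht : 0 < t) ↦
      mul_nonneg (Real.rpow_nonneg ht.le _) (pieceF_nonneg _ _ _ _ _ _))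
  rw [integral_eq_lintegral_of_nonneg_ae hnn (integrableOn_rpow_mul_pieceF p ς I a₀ hN0 hN hV hσ).1]
  have h := lintegral_rpow_mul_pieceF_eq p ς (I : FractionalIdeal (𝓞 K)⁰ K) a₀ hN0 hN hV hσ0
  have heq : ∫⁻ t in Set.Ioi 0, ENNReal.ofReal (t ^ (σ - 1) * pieceF K p ς (I : FractionalIdeal (𝓞 K)⁰ K) a₀ N t) =
      ∫⁻ t in Set.Ioi 0, ENNReal.ofReal (t ^ (σ - 1)) * ENNReal.ofReal (pieceF K p ς (I : FractionalIdeal (𝓞 K)⁰ K) a₀ N t) :=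
    setLIntegral_congr_fun measurableSet_Ioi fun t (ht : 0 < t) ↦ by
      rw [ENNReal.ofReal_mul (Real.rpow_nonneg ht.le _)]
  rw [heq, h, ENNReal.toReal_mul, ENNReal.toReal_ofReal (mul_pos (pieceCst_pos hN0) (realGammaFactorP_pos p hσ0)).le]

/-- **`Λ(σ)` at real `σ > 1/2` as signed norm sums over the representatives** (Neukirch VII (8.3):
`Λ(𝔎,χ,s) = L(f, s/2)`, with the Gamma integrals evaluated and the class sum unfolded, here for the coset
`a₀ + 𝔞` with sign weight `p` modulo `V = ⟨u_i^N⟩`): for the weak FE-pair `P = heckePairW K p 𝔞 a₀ N`,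
`Λ_P(σ) = c_N A_p(σ) (S⁺_p(2σ) - S⁻_p(2σ))`. [cite: NeukirchANT1999, Ch. VII §8 (8.3) Proposition] -/
theorem heckePairW_Λ_real_eq (p : Finset {w : InfinitePlace K // IsReal w}) (I : (FractionalIdeal (𝓞 K)⁰ K)ˣ)
    (a₀ : K) {N : ℕ} (hN0 : N ≠ 0) (hN : Even N)
    (hV : ∀ i, (((fundSystem K i : (𝓞 K)ˣ) : K) ^ N - 1) * a₀ ∈ (I : FractionalIdeal (𝓞 K)⁰ K))
    {σ : ℝ} (hσ : 1 / 2 < σ) :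
    (heckePairW K p I a₀ N).Λ σ =
      ((pieceCst K N * realGammaFactorP K p σ *
        ((pieceNormSum K p 1 (I : FractionalIdeal (𝓞 K)⁰ K) a₀ N (2 * σ)).toReal -
          (pieceNormSum K p (-1) (I : FractionalIdeal (𝓞 K)⁰ K) a₀ N (2 * σ)).toReal) : ℝ) : ℂ) := by
  set P := heckePairW K p I a₀ N with hP
  have hk : P.k < (σ : ℂ).re := by simp only [hP, heckePairW, Complex.ofReal_re]; exact hσ
  obtain ⟨-, hmel⟩ := P.hasMellin hk
  set g₁ : ℝ → ℝ := fun t ↦ t ^ (σ - 1) * pieceF K p 1 (I : FractionalIdeal (𝓞 K)⁰ K) a₀ N t with hg₁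
  set g₂ : ℝ → ℝ := fun t ↦ t ^ (σ - 1) * pieceF K p (-1) (I : FractionalIdeal (𝓞 K)⁰ K) a₀ N t with hg₂
  have hint_eq : Set.EqOn (fun t : ℝ ↦ (t : ℂ) ^ ((σ : ℂ) - 1) • (P.f t - P.f₀))
      (fun t : ℝ ↦ ((g₁ t - g₂ t : ℝ) : ℂ)) (Set.Ioi 0) := by
    intro t ht
    simp only [hP, heckePairW, smul_eq_mul, hg₁, hg₂]
    rw [heckeFW_sub_const_eq_pieceF_sub, Complex.ofReal_sub, Complex.ofReal_mul, Complex.ofReal_mul,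
      Complex.ofReal_cpow (le_of_lt ht)]
    push_cast
    ring
  have h1 := integrableOn_rpow_mul_pieceF p 1 I a₀ hN0 hN hV hσ
  have h2 := integrableOn_rpow_mul_pieceF p (-1) I a₀ hN0 hN hV hσ
  rw [← hmel, mellin, setIntegral_congr_fun measurableSet_Ioi hint_eq, integral_complex_ofReal,
    integral_sub h1 h2, integral_rpow_mul_pieceF_eq p 1 I a₀ hN0 hN hV hσ,
    integral_rpow_mul_pieceF_eq p (-1) I a₀ hN0 hN hV hσ]
  push_cast
  ring

end NumberField

end Literature.NumberTheory.LFunctions
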